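import Literature.IUT.LogThetaLattice.HolomorphicLogShellVolume
import HarnessLib

/-!
# [IUTchIII] Prop 1.2 (vi) / [AbsTopIII] Prop 5.8 (iii): the row `HolMonoVolumeCompatible L t` (FACT-LIST F-0428)
# decided — binder-free instance at THE type of `K`, universal closure in `t` refuted at every model

S. Mochizuki, *Inter-universal Teichmüller Theory III*, kurims manuscript, §1 Prop 1.2 (vi) p. 32 (claim key
`Mochizuki2012`, D-0012, status disputed); S. Mochizuki, *Topics in absolute anabelian geometry III*,
J. Math. Sci. Univ. Tokyo **22** (2015) [MochizukiAbsTopIII2015], Prop 5.8 (i), (iii) pp. 139–140 (the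
mono-analytic value `μ^log(ℐ(G)) = {-1 - m/f + e·log(p*)/log p}·f·log p`), manuscript pages.

PROOF-ONLY companion (no definition, no instance) of abc-iut-L6-t3's `HolomorphicLogShells.lean` (the decl,
FACT-LIST row **F-0428**, L-F family LF4 [AbsTop*]+[AbsAnab], `LABEL-OPEN`, residual = abc-iut-L6-d2's
CONDITIONAL-INSTANCE `holMonoVolumeCompatible_ofUnitLog (t) (hp) (hf) (he) (hm)` of
`HolomorphicLogShellVolume.lean`) — the same bookkeeping abc-iut-f-103 / abc-iut-w5-d246 did for the sibling
rows F-0162 / F-0163 (`MonoAnalyticLogShellVolumeNegative.lean`, `MonoAnalyticLogShellVolumeOfTypeAtK.lean`).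

The typed named fact

  `HolMonoVolumeCompatible (L : PadicLogOnUnits K) (t : MLFType) : Prop :=
     localLogVolume K (logShell L) = t.logShellLogVolume`

has a FREE numerical type `t = (p, f, e, m)`, while its left-hand side does not mention `t`; and
`t.logShellLogVolume = (c·e·f − f − m)·log p` (`MLFType.logShellLogVolume_eq'`, `c ∈ {1, 2}`) is strictly
decreasing in `m`.  Hence, with NO hypothesis on `K` or on the `p`-adic-logarithm structure `L`:

* `HolMonoVolumeCompatible.m_eq` — two types with the same `(p, f, e)` at which the row holds have the same `m`;
* `not_holMonoVolumeCompatible_and_succ_m`, `not_forall_type_holMonoVolumeCompatible` — the closure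
  `∀ t, HolMonoVolumeCompatible L t` is FALSE at EVERY `(K, L)`; `not_forall_holMonoVolumeCompatible` — so is
  the fully quantified closure over `(K, L, t)` (0 binders, unconditional; witness `K = ℚ_2`).

What print asserts is the instance at THE logarithm and THE type of the field: at the standard model
`L = PadicLogOnUnits.ofUnitLog p K` (abc-iut-S1's real `p`-adic logarithm, abc-iut-L3-t11's merge) and
`t = (p, f_K, e_K, m_K)` (`residueDegree`, `absRamificationIdx`, `torsionPExp` of abc-iut-S1/S8):

* `holMonoVolumeCompatible_ofUnitLog_typeOf` — the row HOLDS with NO Prop binder (abc-iut-L6-d2's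
  `holMonoVolumeCompatible_ofUnitLog` with `hp hf he hm := rfl`);
* `holMonoVolumeCompatible_ofUnitLog_iff` — for `t = (p, f_K, e_K, m)` it holds IFF `m = m_K`
  (`not_holMonoVolumeCompatible_ofUnitLog_of_ne` for `m ≠ m_K`), and
  `holMonoVolumeCompatible_iff_monoAnalyticLogShellVolume_ofUnitLog` — at such `t` it is EQUIVALENT to the
  sibling row F-0162 `MonoAnalyticLogShellVolume (ofUnitLog p K) t` (abc-iut-L6-d2's
  `monoAnalyticLogShellVolume_ofUnitLog_iff`).

So F-0428 is admissible ONLY in instance form (FACT-LIST rule R5), and that instance is a theorem.  Classical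
local-field bookkeeping on OUR typed statement; an assumption label, not an endorsement; nothing here bears
on the disputed [IUTchIII] Cor. 3.12 or takes a side on any author.
-/

set_option autoImplicit false

noncomputable section

namespace Literature.IUT.LogThetaLattice

open Literature.AnabelianGeometry.AbsoluteAnabelian
open Literature.IUT.LogVolume (absRamificationIdx residueDegree torsionPExp absRamificationIdx_pos
  residueDegree_pos)

/-! ## §1 At EVERY model `(K, L)`: the row pins `m`, so its closure in `t` is false -/

section AnyModel

variable {K : Type*} [NontriviallyNormedField K] [IsUltrametricDist K] [ProperSpace K] [MeasurableSpace K]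
  [BorelSpace K] (L : PadicLogOnUnits K)

/-- **F-0428 pins the fourth invariant:** if `HolMonoVolumeCompatible L t₁` and `HolMonoVolumeCompatible L t₂`
for two numerical types with the same `(p, f, e)`, then `t₁.m = t₂.m` — both right-hand sides equal the one
real number `μ^log(ℐ_L)`, and `(c·e·f − f − m)·log p` is injective in `m` (`log p ≠ 0`).
[cite: MochizukiAbsTopIII2015, Prop 5.8 (iii) p. 140] -/
theorem HolMonoVolumeCompatible.m_eq {t₁ t₂ : MLFType} (h₁ : HolMonoVolumeCompatible L t₁)
    (h₂ : HolMonoVolumeCompatible L t₂) (hp : t₁.p = t₂.p) (hf : t₁.f = t₂.f) (he : t₁.e = t₂.e) :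
    t₁.m = t₂.m := by
  unfold HolMonoVolumeCompatible at h₁ h₂
  have h : t₁.logShellLogVolume = t₂.logShellLogVolume := h₁.symm.trans h₂
  rw [MLFType.logShellLogVolume_eq', MLFType.logShellLogVolume_eq', hp, hf, he] at h
  have hlog : Real.log t₂.p ≠ 0 := t₂.log_p_pos.ne'
  have h' := mul_right_cancel₀ hlog h
  have hm : (t₁.m : ℝ) = t₂.m := by linarith
  exact_mod_cast hm

/-- **No two consecutive `m`:** at every `(K, L)` and every type `t`, the row fails at `t` or at `t` with
`m + 1` in place of `m`. [cite: MochizukiAbsTopIII2015, Prop 5.8 (iii) p. 140] -/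
theorem not_holMonoVolumeCompatible_and_succ_m (t : MLFType) :
    ¬ (HolMonoVolumeCompatible L t ∧
        HolMonoVolumeCompatible L ⟨t.p, t.prime_p, t.f, t.f_pos, t.e, t.e_pos, t.m + 1⟩) :=
  fun h => Nat.succ_ne_self t.m (HolMonoVolumeCompatible.m_eq L h.2 h.1 rfl rfl rfl)

/-- **The `t`-closure of F-0428 is false at EVERY model `(K, L)`** — no hypothesis on the field or on the
`p`-adic-logarithm structure: `¬ ∀ t, HolMonoVolumeCompatible L t` (witness pair `(2, 1, 1, 0)`, `(2, 1, 1, 1)`).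
[cite: MochizukiAbsTopIII2015, Prop 5.8 (iii) p. 140] -/
theorem not_forall_type_holMonoVolumeCompatible : ¬ ∀ t : MLFType, HolMonoVolumeCompatible L t :=
  fun h => not_holMonoVolumeCompatible_and_succ_m L ⟨2, Nat.prime_two, 1, Nat.one_pos, 1, Nat.one_pos, 0⟩
    ⟨h _, h _⟩

/-- hence at every `(K, L)` the row is REFUTABLE in `t`: some numerical type violates it.
[cite: MochizukiAbsTopIII2015, Prop 5.8 (iii) p. 140] -/
theorem exists_not_holMonoVolumeCompatible : ∃ t : MLFType, ¬ HolMonoVolumeCompatible L t :=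
  not_forall.mp (not_forall_type_holMonoVolumeCompatible L)

end AnyModel

/-- **FACT-LIST F-0428, universal closure REFUTED (0 binders, unconditional):** it is not the case that
`HolMonoVolumeCompatible L t` holds for every proper ultrametric normed field `K` with its Borel σ-algebra,
every `p`-adic-logarithm structure `L` on it and every numerical type `t` — witness `K = ℚ_2`,
`L = ofUnitLog 2 ℚ_2`, and the pair of types of `not_forall_type_holMonoVolumeCompatible`.
[cite: MochizukiAbsTopIII2015, Prop 5.8 (iii) p. 140] -/
theorem not_forall_holMonoVolumeCompatible :
    ¬ ∀ (F : Type) [NontriviallyNormedField F] [IsUltrametricDist F] [ProperSpace F] [MeasurableSpace F]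
        [BorelSpace F] (L : PadicLogOnUnits F) (t : MLFType), HolMonoVolumeCompatible L t := by
  intro h
  haveI : Fact (Nat.Prime 2) := ⟨Nat.prime_two⟩
  borelize ℚ_[2]
  exact not_forall_type_holMonoVolumeCompatible (PadicLogOnUnits.ofUnitLog 2 ℚ_[2]) (h ℚ_[2] _)

/-! ## §2 At THE `p`-adic logarithm of `K`: the instance form, binder-free, and the exact range of validity -/

section StandardModel

variable (p : ℕ) [Fact p.Prime]
variable (K : Type*) [NontriviallyNormedField K] [NormedAlgebra ℚ_[p] K] [IsUltrametricDist K]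
  [ProperSpace K] [MeasurableSpace K] [BorelSpace K]

/-- **IUTchIII:Prop1.2(vi) / F-0428 AT THE `p`-adic logarithm of `K` and THE type `(p, f_K, e_K, m_K)` of `K`**
— NO Prop binder: the holomorphic log-shell `ℐ_K = (p*)⁻¹·log_p(𝒪_K^×)` has log-volume the mono-analytic
value `{-1 - m_K/f_K + e_K·log(p*)/log p}·(f_K·log p)` of [AbsTopIII] Prop 5.8 (iii); abc-iut-L6-d2's
`holMonoVolumeCompatible_ofUnitLog` with `hp hf he hm := rfl`. [claim: Mochizuki2012, status: disputed] -/
theorem holMonoVolumeCompatible_ofUnitLog_typeOf :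
    Literature.IUT.LogThetaLattice.HolMonoVolumeCompatible (PadicLogOnUnits.ofUnitLog p K)
      ⟨p, Fact.out, residueDegree p K, residueDegree_pos p K, absRamificationIdx p K,
        absRamificationIdx_pos p K, torsionPExp p K⟩ :=
  holMonoVolumeCompatible_ofUnitLog p K _ rfl rfl rfl rfl

/-- **F-0428 at the standard model, exact range:** for the type `(p, f_K, e_K, m)` the row holds IF AND
ONLY IF `m = m_K := torsionPExp p K` (the instance above, and `HolMonoVolumeCompatible.m_eq` against it).
[claim: Mochizuki2012, status: disputed] -/
theorem holMonoVolumeCompatible_ofUnitLog_iff (m : ℕ) :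
    Literature.IUT.LogThetaLattice.HolMonoVolumeCompatible (PadicLogOnUnits.ofUnitLog p K)
        ⟨p, Fact.out, residueDegree p K, residueDegree_pos p K, absRamificationIdx p K,
          absRamificationIdx_pos p K, m⟩ ↔
      m = torsionPExp p K :=
  ⟨fun h => HolMonoVolumeCompatible.m_eq _ h (holMonoVolumeCompatible_ofUnitLog_typeOf p K) rfl rfl rfl,
    fun hm => holMonoVolumeCompatible_ofUnitLog p K _ rfl rfl rfl hm⟩

/-- **F-0428 at the standard model, wrong `m`:** for `m ≠ m_K` the row is FALSE at `(p, f_K, e_K, m)`.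
[claim: Mochizuki2012, status: disputed] -/
theorem not_holMonoVolumeCompatible_ofUnitLog_of_ne (m : ℕ) (hm : m ≠ torsionPExp p K) :
    ¬ Literature.IUT.LogThetaLattice.HolMonoVolumeCompatible (PadicLogOnUnits.ofUnitLog p K)
        ⟨p, Fact.out, residueDegree p K, residueDegree_pos p K, absRamificationIdx p K,
          absRamificationIdx_pos p K, m⟩ :=
  fun h => hm ((holMonoVolumeCompatible_ofUnitLog_iff p K m).mp h)

/-- hence at the standard model the row is SATISFIABLE and REFUTABLE in `t`: a schema whose instance form
only is admissible (FACT-LIST rule R5). [claim: Mochizuki2012, status: disputed] -/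
theorem exists_holMonoVolumeCompatible_ofUnitLog_and_exists_not :
    (∃ t : MLFType, Literature.IUT.LogThetaLattice.HolMonoVolumeCompatible (PadicLogOnUnits.ofUnitLog p K) t) ∧
      ∃ t : MLFType,
        ¬ Literature.IUT.LogThetaLattice.HolMonoVolumeCompatible (PadicLogOnUnits.ofUnitLog p K) t :=
  ⟨⟨_, holMonoVolumeCompatible_ofUnitLog_typeOf p K⟩,
    ⟨_, not_holMonoVolumeCompatible_ofUnitLog_of_ne p K (torsionPExp p K + 1) (Nat.succ_ne_self _)⟩⟩

/-- **F-0428 ⟺ F-0162 at the standard model:** for the type `(p, f_K, e_K, m)` — any `m` — the holomorphic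
row `HolMonoVolumeCompatible (ofUnitLog p K) t` ([IUTchIII] Prop 1.2 (vi)) and abc-iut-L4-t3's mono-analytic
row `MonoAnalyticLogShellVolume (ofUnitLog p K) t` ([AbsTopIII] Cor 5.10 (iv)(d)) are EQUIVALENT: both hold
iff `m = m_K` (abc-iut-L6-d2's `monoAnalyticLogShellVolume_ofUnitLog_iff`).
[cite: MochizukiAbsTopIII2015, Cor 5.10 (iv)(d) p. 148] -/
theorem holMonoVolumeCompatible_iff_monoAnalyticLogShellVolume_ofUnitLog (m : ℕ) :
    Literature.IUT.LogThetaLattice.HolMonoVolumeCompatible (PadicLogOnUnits.ofUnitLog p K)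
        ⟨p, Fact.out, residueDegree p K, residueDegree_pos p K, absRamificationIdx p K,
          absRamificationIdx_pos p K, m⟩ ↔
      MonoAnalyticLogShellVolume (PadicLogOnUnits.ofUnitLog p K)
        ⟨p, Fact.out, residueDegree p K, residueDegree_pos p K, absRamificationIdx p K,
          absRamificationIdx_pos p K, m⟩ := by
  rw [holMonoVolumeCompatible_ofUnitLog_iff p K m, monoAnalyticLogShellVolume_ofUnitLog_iff p K _ rfl rfl rfl]

end StandardModel

end Literature.IUT.LogThetaLattice

end
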